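import Summits.Ventures.YMGap.RobustBall.StateTaylorRemainderTwoS
import Literature.Probability.LatticeModels.RescaledUrsellUniformOnCompact
import HarnessLib

/-!
# Venture YMGap, track ROBUST-BALL (Y2) — TIER 2: THE STATE IS `C²` ALONG EVERY DIRECTION OF FINITE SIZE-WEIGHTED LOAD — THE SUSCEPTIBILITY SERIES
# IS DIFFERENTIABLE ALONG THE LINE, WITH DERIVATIVE THE ABSOLUTELY CONVERGENT DOUBLE SERIES OF THIRD CUMULANTS

HONEST FRAMING. WHAT THIS IS: a venture file (cell `pub-ymgap`, track Y2 ROBUST-BALL, seat rb-p1, theorems only).  Member `W ∈ Ball(a, Λ, t)`,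
direction `V ∈ Ball(a_V, Λ_V, t)` with Frobenius-Lipschitz witnesses of total load `≤ L` and size-weighted load `≤ L₂`, `a + s₀a_V ≤ a'`,
`Λ + s₀Λ_V ≤ Λ'`, pair door `ρ' < 1` at `(a', Λ', t)`, `t > 0`; `ν(s) ∈ 𝒢(W + sV)` on `|s| ≤ s₀`; `F` bounded measurable local Frobenius-Lipschitz:
* ★★★ `hasDerivAt_tsum_cov_direction_S` — for a second ("observable") direction `V'` with Lipschitz witnesses of loads `(L', L₂')`: at every
  `|s| < s₀`, the susceptibility series `s ↦ Σ'_X cov_{ν(s)}(F, V'_X)` (= `−∂_{V'} ⟨F⟩` at `W + sV`, `StateDerivativeOnBallS`) is (i) DIFFERENTIABLE with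
  derivative `−Σ'_{(X,Y)} u₃^{ν(s)}(F; V'_X; V_Y)`, the absolutely convergent double cumulant series of `SecondSusceptibilityS` — the SECOND GATEAUX
  DIFFERENTIAL of the state as a bilinear form on pairs of directions; with `V' = V`: `s ↦ ⟨F⟩_{W+sV}` is twice differentiable on `(−s₀, s₀)` with
  `d²/ds² ⟨F⟩ = Σ'_{(X,Y)} u₃(F; V_X; V_Y)`; and (ii) the double cumulant series is CONTINUOUS in `s` on `|s| ≤ s₀`.
  Mechanism: Feynman–Hellmann for covariances along the truncated lines (`StateTaylorRemainderTwoS`), the member-independent summable majorant of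
  the third cumulants (`SecondSusceptibilityMajorantS`), uniform convergence of third cumulants along truncations (screened stability + products
  of uniformly convergent bounded families), and the truncated-series lemmas of `TruncatedSeriesDerivative` on PAIRS of link sets;
* ★★★ `contDiffOn_two_integral_direction_S` — THE STATE IS `C²` ALONG EVERY SUCH LINE OF THE BALL: `s ↦ ⟨F⟩_{W+sV}` is `ContDiffOn ℝ 2` on
  `(−s₀, s₀)` (first derivative `−Σ'_X cov(F, V_X)` by `StateDerivativeOnBallS`, second derivative the continuous double cumulant series).
WHAT THIS IS NOT: `C³` or analyticity along lines; a modulus of continuity for the second derivative; one-sided Dobrushin-comparison constants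
at lattice strong coupling; nothing about the continuum limit or a Clay-sense mass gap.
-/

noncomputable section

open MeasureTheory Function Finset ProbabilityTheory Real Filter Topology
open scoped NNReal
open Literature.Probability.LatticeModels
open Literature.Probability.LatticeModels.DobrushinMetric
open Literature.MathematicalPhysics.QuantumLattice
open Literature.MathematicalPhysics.QuantumFieldTheory hiding ZdEdge
open Summit.QuantumFields.BalabanUV.InfraRed.StrongCouplingPoincareDoorSUN (oneLinkPoincareSUN_two_sharp)

namespace Summit.Ventures.YMGap.RobustBall

variable {d N : ℕ}

/-! ### The second derivative along a direction -/

section SUN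

variable {W V V' : Potential (ZdEdge d) (Matrix.specialUnitaryGroup (Fin N) ℂ)}

/-- ★★★ **THE SUSCEPTIBILITY SERIES OF ONE DIRECTION IS DIFFERENTIABLE ALONG ANOTHER; ITS DERIVATIVE IS THE DOUBLE CUMULANT SERIES** (the second
Gateaux differential of the state as a bilinear form on pairs of directions).  Member `W ∈ Ball(a, Λ, t)`, line direction `V ∈ Ball(a_V, Λ_V, t)` with
Lipschitz witnesses of total load `≤ L` and size-weighted load `≤ L₂`, `a + s₀a_V ≤ a'`, `Λ + s₀Λ_V ≤ Λ'`, pair door `ρ' < 1` at `(a', Λ', t)`, `t > 0`;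
`ν(s) ∈ 𝒢(W + sV)` on `|s| ≤ s₀`; observable direction `V'`: continuous own-link terms with Lipschitz witnesses of loads `≤ L'`, `≤ L₂'`; `F` bounded
measurable local Frobenius-Lipschitz.  Then (i) at every `|s| < s₀`: `HasDerivAt (s ↦ Σ'_X cov_{ν(s)}(F, V'_X)) (−Σ'_{(X,Y)} u₃^{ν(s)}(F; V'_X; V_Y)) s`,
and (ii) the double cumulant series `s ↦ Σ'_{(X,Y)} u₃^{ν(s)}(F; V'_X; V_Y)` is CONTINUOUS on `|s| ≤ s₀` (uniform limit of the pair-truncated sums,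
each continuous by the tilt formula).  With `V' = V` this is the second derivative along the line (`contDiffOn_two_integral_direction_S`). -/
theorem hasDerivAt_tsum_cov_direction_S (hd : 1 ≤ d) (hN : 1 ≤ N) {β b c v a' Λ' t : ℝ}
    (hc : 0 ≤ c) (hv : 0 ≤ v) (hb : |β| * (2 * ((d : ℝ) - 1)) ≤ b)
    (hP : ∀ B : Matrix (Fin N) (Fin N) ℂ, matrixOpNorm B ≤ b →
      ∀ (ψ : Matrix.specialUnitaryGroup (Fin N) ℂ → ℝ) (M : ℝ), 0 ≤ M →
        (∀ x y, |ψ x - ψ y| ≤ M * suFrobDist x y) →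
        Var[ψ; (haarProbability (Matrix.specialUnitaryGroup (Fin N) ℂ)).tilted
          fun g => (N : ℝ) * ((g : Matrix (Fin N) (Fin N) ℂ) * B).trace.re] ≤ c * M ^ 2)
    (hVB : ∀ B : Matrix (Fin N) (Fin N) ℂ, matrixOpNorm B ≤ b → ∀ Δ : Matrix (Fin N) (Fin N) ℂ,
      Var[fun g : Matrix.specialUnitaryGroup (Fin N) ℂ =>
          (N : ℝ) * ((g : Matrix (Fin N) (Fin N) ℂ) * Δ).trace.re;
        (haarProbability (Matrix.specialUnitaryGroup (Fin N) ℂ)).tilted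
          fun g => (N : ℝ) * ((g : Matrix (Fin N) (Fin N) ℂ) * B).trace.re] ≤ v * frobNorm Δ ^ 2)
    (ht : 0 < t) (hρ : 6 * ((d : ℝ) - 1) * |β| * (exp a' * exp t * Real.sqrt (c * v)) + exp (a' / 2) * Real.sqrt c * Λ' < 1)
    {a Λ aV ΛV s₀ : ℝ} (hW : MemBallZdS a Λ t W) (hV : MemBallZdS aV ΛV t V) (haV : 0 ≤ aV) (hΛV : 0 ≤ ΛV)
    (hs₀ : 0 < s₀) (ha' : a + s₀ * aV ≤ a') (hΛ' : Λ + s₀ * ΛV ≤ Λ')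
    {lipV : Finset (ZdEdge d) → ZdEdge d → ℝ} (hlipV : ∀ X, IsLipBound suFrobDist (V X) (lipV X)) {L L₂ : ℝ}
    (hLs : ∀ e, Summable fun X : Finset (ZdEdge d) => (if e ∈ X then ∑ y ∈ X, lipV X y else 0))
    (hL : ∀ e, ∑' X : Finset (ZdEdge d), (if e ∈ X then ∑ y ∈ X, lipV X y else 0) ≤ L)
    (hL2s : ∀ e, Summable fun X : Finset (ZdEdge d) => (if e ∈ X then X.card * ∑ y ∈ X, lipV X y else 0))
    (hL2 : ∀ e, ∑' X : Finset (ZdEdge d), (if e ∈ X then X.card * ∑ y ∈ X, lipV X y else 0) ≤ L₂)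
    (hV'c : ∀ X, Continuous (V' X)) (hV'dep : ∀ X, DependsOn (V' X) (↑X : Set (ZdEdge d)))
    {lipV' : Finset (ZdEdge d) → ZdEdge d → ℝ} (hlipV' : ∀ X, IsLipBound suFrobDist (V' X) (lipV' X)) {L' L₂' : ℝ}
    (hL's : ∀ e, Summable fun X : Finset (ZdEdge d) => (if e ∈ X then ∑ y ∈ X, lipV' X y else 0))
    (hL' : ∀ e, ∑' X : Finset (ZdEdge d), (if e ∈ X then ∑ y ∈ X, lipV' X y else 0) ≤ L')
    (hL2's : ∀ e, Summable fun X : Finset (ZdEdge d) => (if e ∈ X then X.card * ∑ y ∈ X, lipV' X y else 0))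
    (hL2' : ∀ e, ∑' X : Finset (ZdEdge d), (if e ∈ X then X.card * ∑ y ∈ X, lipV' X y else 0) ≤ L₂')
    {ν : ℝ → Measure (LGConfig d (Matrix.specialUnitaryGroup (Fin N) ℂ))}
    (hν : ∀ s ∈ Set.Icc (-s₀) s₀, ν s ∈ perturbedGibbsMeasuresS (d := d) (fundamentalRep (Fin N)) (N * β) (W + s • V))
    {F : LGConfig d (Matrix.specialUnitaryGroup (Fin N) ℂ) → ℝ} (hFm : Measurable F) {ΛF : Finset (ZdEdge d)}
    (hFdep : DependsOn F (↑ΛF : Set (ZdEdge d))) {MF : ℝ} (hMF : ∀ σ, |F σ| ≤ MF) {δF : ZdEdge d → ℝ}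
    (hδF : IsLipBound suFrobDist F δF) :
    (∀ s ∈ Set.Ioo (-s₀) s₀, HasDerivAt (fun s => ∑' X : Finset (ZdEdge d), cov[F, V' X; ν s])
      (-(∑' p : Finset (ZdEdge d) × Finset (ZdEdge d), (cov[fun U => F U * V' p.1 U, V p.2; ν s] -
        (∫ U, F U ∂(ν s)) * cov[V' p.1, V p.2; ν s] - (∫ U, V' p.1 U ∂(ν s)) * cov[F, V p.2; ν s]))) s) ∧
    ContinuousOn (fun s => ∑' p : Finset (ZdEdge d) × Finset (ZdEdge d), (cov[fun U => F U * V' p.1 U, V p.2; ν s] -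
        (∫ U, F U ∂(ν s)) * cov[V' p.1, V p.2; ν s] - (∫ U, V' p.1 U ∂(ν s)) * cov[F, V p.2; ν s])) (Set.Icc (-s₀) s₀) := by
  classical
  haveI : SecondCountableTopology (Matrix (Fin N) (Fin N) ℂ) :=
    inferInstanceAs (SecondCountableTopology (Fin N → Fin N → ℂ))
  haveI : SecondCountableTopology (Matrix.specialUnitaryGroup (Fin N) ℂ) :=
    Topology.IsEmbedding.subtypeVal.secondCountableTopology
  set I : Set ℝ := Set.Ioo (-s₀) s₀ with hI; set J : Set ℝ := Set.Icc (-s₀) s₀ with hJ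
  have hII : I ⊆ J := Set.Ioo_subset_Icc_self
  have habs : ∀ {s}, s ∈ J → |s| ≤ s₀ := fun hs => abs_le.2 ⟨by linarith [hs.1], hs.2⟩
  obtain ⟨T, hT⟩ := exists_term_exhaustion d
  -- the member `W` at the bigger loads: uniqueness and a state `μ`
  have hW' : MemBallZdS a' Λ' t W := hW.mono (by nlinarith) (by nlinarith)
  obtain ⟨BW, hBW⟩ := hW'.summable
  obtain ⟨osc, lip, ℓ, hosc, hlip, hoscs, hosca, hlips, hℓ, hℓs, hℓt⟩ := hW'.loads
  have huniq := subsingleton_perturbedGibbsMeasuresS_SU hd hN hc hv hb hP hVB hBW hW'.continuous hW'.dependsOn hosc hoscs hosca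
    hlip hlips hℓ ht.le hℓs hℓt hρ
  obtain ⟨μ, hμ⟩ := perturbedGibbsMeasuresS_nonempty _ (continuous_fundamentalRep (Fin N)) _ hBW hW'.continuous hW'.dependsOn
  have hVb : ∀ X, ∃ C, ∀ U, |V X U| ≤ C := fun X => exists_bound_of_continuous (hV.continuous X)
  have hVm : ∀ X, Measurable (V X) := fun X => (hV.continuous X).measurable
  have hVb' : ∀ X, ∃ C, ∀ U, |V' X U| ≤ C := fun X => exists_bound_of_continuous (hV'c X)
  have hV'm : ∀ X, Measurable (V' X) := fun X => (hV'c X).measurable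
  set Vn : ℕ → Potential (ZdEdge d) (Matrix.specialUnitaryGroup (Fin N) ℂ) := fun n => (↑(T n) : Set (Finset (ZdEdge d))).indicator V
    with hVn
  have hVnc : ∀ n X, Continuous (Vn n X) := fun n X => continuous_indicator_apply hV.continuous X
  have hVndep : ∀ n X, DependsOn (Vn n X) (↑X : Set (ZdEdge d)) := fun n X => dependsOn_indicator_apply hV.dependsOn X
  have hVnsupp : ∀ n, (Vn n).IsSupportedBy fun _ => T n := fun n => isSupportedBy_indicator (T n) V
  set νn : ℕ → ℝ → Measure (LGConfig d (Matrix.specialUnitaryGroup (Fin N) ℂ)) :=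
    fun n s => μ.tilted fun U => -s * ∑ A ∈ T n, Vn n A U with hνn_def
  have hνn : ∀ n s, νn n s ∈ perturbedGibbsMeasuresS (d := d) (fundamentalRep (Fin N)) (N * β) (W + s • Vn n) := fun n s => by
    rw [perturbedGibbsMeasuresS_add_smul_eq_singleton (fundamentalRep (Fin N)) (continuous_fundamentalRep (Fin N)) (N * β) hBW
      hW'.continuous hW'.dependsOn (hVnc n) (hVndep n) (hVnsupp n) (fun _ => subset_rfl) huniq hμ s]
    exact Set.mem_singleton _
  have hprob_n : ∀ n s, IsProbabilityMeasure (νn n s) := fun n s => (show IsGibbsMeasure _ _ from hνn n s).isProbabilityMeasure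
  have hprob : ∀ s ∈ J, IsProbabilityMeasure (ν s) := fun s hs => (show IsGibbsMeasure _ _ from hν s hs).isProbabilityMeasure
  have hmemn : ∀ n, ∀ s ∈ J, MemBallZdS a' Λ' t (W + s • Vn n) := fun n s hs => memBallZdS_add_smul_indicator hW hV haV hΛV ha' hΛ' (habs hs) _
  have hmem : ∀ s ∈ J, MemBallZdS a' Λ' t (W + s • V) := fun s hs => by
    have hm := memBallZdS_add_smul_indicator hW hV haV hΛV ha' hΛ' (habs hs) Set.univ
    rwa [Set.indicator_univ] at hm
  -- uniform convergence of expectations along the truncations (screened stability)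
  have hunif : ∀ {g : LGConfig d (Matrix.specialUnitaryGroup (Fin N) ℂ) → ℝ} {Δ : Finset (ZdEdge d)} {M : ℝ} {δ : ZdEdge d → ℝ},
      Measurable g → DependsOn g (↑Δ : Set (ZdEdge d)) → (∀ σ, |g σ| ≤ M) → IsLipBound suFrobDist g δ →
      TendstoUniformlyOn (fun n s => ∫ σ, g σ ∂(νn n s)) (fun s => ∫ σ, g σ ∂(ν s)) atTop J :=
    fun hgm hgdep hM hδ => tendstoUniformlyOn_integral_truncation_S hd hN hc hv hb hP hVB ht hρ hW hV haV hΛV hs₀.le ha' hΛ' hT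
      (fun n s _ => hνn n s) hν hgm hgdep hM hδ
  have hMF0 : 0 ≤ MF := (abs_nonneg _).trans (hMF fun _ => 1)
  -- uniform convergence of covariances of bounded local Lipschitz observables
  have hcovconv : ∀ {f g : LGConfig d (Matrix.specialUnitaryGroup (Fin N) ℂ) → ℝ} {Δf Δg : Finset (ZdEdge d)} {Mf Mg : ℝ}
      {δf δg : ZdEdge d → ℝ}, Measurable f → DependsOn f (↑Δf : Set (ZdEdge d)) → (∀ σ, |f σ| ≤ Mf) → IsLipBound suFrobDist f δf →
      Measurable g → DependsOn g (↑Δg : Set (ZdEdge d)) → (∀ σ, |g σ| ≤ Mg) → IsLipBound suFrobDist g δg →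
      TendstoUniformlyOn (fun n s => cov[f, g; νn n s]) (fun s => cov[f, g; ν s]) atTop J := by
    intro f g Δf Δg Mf Mg δf δg hfm hfdep hMf hδf hgm hgdep hMg hδg
    have hMf0 : 0 ≤ Mf := (abs_nonneg _).trans (hMf fun _ => 1)
    have hMg0 : 0 ≤ Mg := (abs_nonneg _).trans (hMg fun _ => 1)
    exact tendstoUniformlyOn_cov (fun n s _ => hprob_n n s) (fun s hs => hprob s hs) hfm hgm hMf0 hMg0 hMf hMg (hunif hfm hfdep hMf hδf)
      (hunif hgm hgdep hMg hδg) (hunif (hfm.mul hgm) (dependsOn_mul_union hfdep hgdep)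
        (fun σ => by rw [abs_mul]; exact mul_le_mul (hMf σ) (hMg σ) (abs_nonneg _) hMf0)
        (isLipBound_mul_of_abs_le (fun _ _ => suFrobDist_nonneg _ _) hMf0 hMg0 hMf hMg hδf hδg))
  -- (1) the first-level series: `χ_n → χ` on `J`
  set A₀ : ℝ := 2 * (2 * Real.sqrt N) ^ 2 * ∑ y ∈ ΛF, δF y with hA₀
  set LX : Finset (ZdEdge d) → ℝ := fun X => ∑ y ∈ X, lipV X y with hLX
  set LX' : Finset (ZdEdge d) → ℝ := fun X => ∑ y ∈ X, lipV' X y with hLX'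
  set g₀ : ZdEdge d → ℝ := fun e => exp (-t * linkSetDist ΛF e) with hg₀
  set Φ : Finset (ZdEdge d) → ℝ := fun X => A₀ * LX' X * ∑ e ∈ X, g₀ e with hΦ
  have hδ0 : 0 ≤ ∑ y ∈ ΛF, δF y := sum_nonneg fun y _ => hδF.nonneg y
  have hA₀0 : 0 ≤ A₀ := by positivity
  have hLX0 : ∀ X, 0 ≤ LX X := fun X => sum_nonneg fun y _ => (hlipV X).nonneg y
  have hLX'0 : ∀ X, 0 ≤ LX' X := fun X => sum_nonneg fun y _ => (hlipV' X).nonneg y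
  have hg₀0 : ∀ e, 0 ≤ g₀ e := fun e => (exp_pos _).le
  have hΦ0 : ∀ X, 0 ≤ Φ X := fun X => mul_nonneg (mul_nonneg hA₀0 (hLX'0 X)) (sum_nonneg fun e _ => hg₀0 e)
  have hd0 : 0 < d := hd
  have hL'0 : 0 ≤ L' := le_trans (tsum_nonneg fun X => by split_ifs; exacts [hLX'0 X, le_rfl]) (hL' (0, ⟨0, hd0⟩))
  have hΦs : Summable Φ := by
    refine summable_of_sum_le hΦ0 (c := A₀ * L' * (ΛF.card * (d * ((1 + exp (-(t / d))) / (1 - exp (-(t / d)))) ^ d)))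
      fun Tf => ?_
    have h1 : ∑ X ∈ Tf, Φ X = A₀ * ∑ X ∈ Tf, LX' X * ∑ e ∈ X, g₀ e := by rw [mul_sum]; exact sum_congr rfl fun X _ => by ring
    rw [h1]
    by_cases hΛF : ΛF.Nonempty
    · obtain ⟨hgs, hgt⟩ := summable_exp_neg_linkSetDist hd ht hΛF
      calc A₀ * ∑ X ∈ Tf, LX' X * ∑ e ∈ X, g₀ e
          ≤ A₀ * (L' * (ΛF.card * (d * ((1 + exp (-(t / d))) / (1 - exp (-(t / d)))) ^ d))) :=
            mul_le_mul_of_nonneg_left ((sum_mul_sum_le_of_load hg₀0 hgs hLX'0 hL'0 hL's hL').trans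
              (mul_le_mul_of_nonneg_left hgt hL'0)) hA₀0
        _ = _ := by ring
    · simp [hA₀, Finset.not_nonempty_iff_eq_empty.1 hΛF]
  have hboundΦ : ∀ {W' : Potential (ZdEdge d) (Matrix.specialUnitaryGroup (Fin N) ℂ)}, MemBallZdS a' Λ' t W' →
      ∀ {μ' : Measure (LGConfig d (Matrix.specialUnitaryGroup (Fin N) ℂ))},
        μ' ∈ perturbedGibbsMeasuresS (d := d) (fundamentalRep (Fin N)) (N * β) W' → ∀ X, |cov[F, V' X; μ']| ≤ Φ X := by
    intro W'' hW'' μ' hμ' X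
    obtain ⟨B', hB'⟩ := hW''.summable
    obtain ⟨osc', lip', ℓ', hosc', hlip', hoscs', hosca', hlips', hℓ', hℓs', hℓt'⟩ := hW''.loads
    obtain ⟨CX, hCX⟩ := hVb' X
    have h1 := abs_cov_le_of_isLipBound_S hd hN hc hv hb hP hVB hB' hW''.continuous hW''.dependsOn hosc' hoscs' hosca' hlip' hlips'
      hℓ' ht.le hℓs' hℓt' hρ hμ' hFm hFdep hMF hδF (hV'm X) (hV'dep X) hCX (hlipV' X)
    refine le_mul_sum_exp_of_le_mul_exp ht.le hA₀0 (hLX'0 X) ?_ (fun hX => ?_) (fun hΔ => ?_)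
    · simpa only [hA₀, hLX', mul_assoc, mul_comm, mul_left_comm] using h1
    · simp only [hLX', Finset.not_nonempty_iff_eq_empty.1 hX, sum_empty]
    · simp only [hA₀, Finset.not_nonempty_iff_eq_empty.1 hΔ, sum_empty, mul_zero]
  have hc₁ : ∀ n, ∀ s ∈ J, ∀ X, |cov[F, V' X; νn n s]| ≤ Φ X := fun n s hs X => hboundΦ (hmemn n s hs) (hνn n s) X
  have hcinf₁ : ∀ s ∈ J, ∀ X, |cov[F, V' X; ν s]| ≤ Φ X := fun s hs X => hboundΦ (hmem s hs) (hν s hs) X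
  have hconv₁ : ∀ X, TendstoUniformlyOn (fun n s => cov[F, V' X; νn n s]) (fun s => cov[F, V' X; ν s]) atTop J := fun X => by
    obtain ⟨CX, hCX⟩ := hVb' X
    exact hcovconv hFm hFdep hMF hδF (hV'm X) (hV'dep X) hCX (hlipV' X)
  have hU₁ := tendstoUniformlyOn_finsetSum_tsum hT hΦ0 hΦs hc₁ hcinf₁ hconv₁
  -- (2) the second-level majorant on pairs
  obtain ⟨Sf, hSf⟩ : ∃ S : ℝ, S = ∑ y ∈ ΛF, δF y := ⟨_, rfl⟩
  obtain ⟨gD, hgD⟩ : ∃ g : Finset (ZdEdge d) → ZdEdge d → ℝ, g = fun Δ e => exp (-(t / 3) * linkSetDist Δ e) := ⟨_, rfl⟩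
  obtain ⟨Cs, hCs⟩ : ∃ C : ℝ, C = (d : ℝ) * ((1 + exp (-(t / 3 / d))) / (1 - exp (-(t / 3 / d)))) ^ d := ⟨_, rfl⟩
  set Φ₂ : Finset (ZdEdge d) × Finset (ZdEdge d) → ℝ := fun p => 768 * N * Real.sqrt N * Sf * (LX' p.1 * LX p.2 *
      ((∑ e ∈ p.1, gD ΛF e) * (∑ e ∈ p.2, gD ΛF e) + (∑ e ∈ p.1, gD ΛF e) * (∑ e ∈ p.2, gD p.1 e) +
        (∑ e ∈ p.2, gD ΛF e) * (∑ e ∈ p.1, gD p.2 e))) with hΦ₂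
  have hSf0 : 0 ≤ Sf := hSf ▸ hδ0
  have hgD0 : ∀ Δ e, 0 ≤ gD Δ e := fun Δ e => by rw [hgD]; exact (exp_pos _).le
  have hΦ₂0 : ∀ p, 0 ≤ Φ₂ p := fun p => by
    have := hLX'0 p.1; have := hLX0 p.2
    have : 0 ≤ ∑ e ∈ p.1, gD ΛF e := sum_nonneg fun e _ => hgD0 _ _
    have : 0 ≤ ∑ e ∈ p.2, gD ΛF e := sum_nonneg fun e _ => hgD0 _ _
    have : 0 ≤ ∑ e ∈ p.2, gD p.1 e := sum_nonneg fun e _ => hgD0 _ _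
    have : 0 ≤ ∑ e ∈ p.1, gD p.2 e := sum_nonneg fun e _ => hgD0 _ _
    simp only [hΦ₂]; positivity
  have hΦ₂s : Summable Φ₂ := by
    refine summable_of_sum_le hΦ₂0
      (c := 768 * N * Real.sqrt N * Sf * (ΛF.card * Cs) * (L' * L * (ΛF.card * Cs) + L * L₂' * Cs + L' * L₂ * Cs)) fun S => ?_
    have hsub : S ⊆ S.image Prod.fst ×ˢ S.image Prod.snd := fun p hp =>
      Finset.mem_product.2 ⟨Finset.mem_image_of_mem _ hp, Finset.mem_image_of_mem _ hp⟩
    refine (Finset.sum_le_sum_of_subset_of_nonneg hsub fun _ _ _ => hΦ₂0 _).trans ?_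
    rw [Finset.sum_product]
    exact sum_majorant_le_S (N := N) (ΛF := ΛF) hd ht hδF.nonneg hlipV' hL's hL' hL2's hL2' hlipV hLs hL hL2s hL2 rfl hSf hLX' hLX hgD
      hCs _ _
  have hbound₂ : ∀ {W' : Potential (ZdEdge d) (Matrix.specialUnitaryGroup (Fin N) ℂ)}, MemBallZdS a' Λ' t W' →
      ∀ {μ' : Measure (LGConfig d (Matrix.specialUnitaryGroup (Fin N) ℂ))},
        μ' ∈ perturbedGibbsMeasuresS (d := d) (fundamentalRep (Fin N)) (N * β) W' → ∀ p : Finset (ZdEdge d) × Finset (ZdEdge d),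
        |cov[fun U => F U * V' p.1 U, V p.2; μ'] - (∫ U, F U ∂μ') * cov[V' p.1, V p.2; μ'] - (∫ U, V' p.1 U ∂μ') * cov[F, V p.2; μ']| ≤
          Φ₂ p :=
    fun hW'' _ hμ' p => abs_threePoint_le_majorant_S hd hN hc hv hb hP hVB ht hρ hW'' hμ' hFm hFdep hMF hδF hV'm hV'dep hVb' hlipV' hVm
      hV.dependsOn hVb hlipV rfl hSf hLX' hLX hgD p.1 p.2
  have hc₂ : ∀ n, ∀ s ∈ J, ∀ p : Finset (ZdEdge d) × Finset (ZdEdge d),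
      |cov[fun U => F U * V' p.1 U, V p.2; νn n s] - (∫ U, F U ∂(νn n s)) * cov[V' p.1, V p.2; νn n s] -
        (∫ U, V' p.1 U ∂(νn n s)) * cov[F, V p.2; νn n s]| ≤ Φ₂ p := fun n s hs p => hbound₂ (hmemn n s hs) (hνn n s) p
  have hcinf₂ : ∀ s ∈ J, ∀ p : Finset (ZdEdge d) × Finset (ZdEdge d),
      |cov[fun U => F U * V' p.1 U, V p.2; ν s] - (∫ U, F U ∂(ν s)) * cov[V' p.1, V p.2; ν s] -
        (∫ U, V' p.1 U ∂(ν s)) * cov[F, V p.2; ν s]| ≤ Φ₂ p := fun s hs p => hbound₂ (hmem s hs) (hν s hs) p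
  -- the exhaustion of pairs
  have hT₂ : Tendsto (fun n => T n ×ˢ T n) atTop atTop := by
    rw [tendsto_atTop_atTop]
    intro S
    obtain ⟨n₀, hn₀⟩ := tendsto_atTop_atTop.1 hT (S.image Prod.fst ∪ S.image Prod.snd)
    refine ⟨n₀, fun n hn p hp => Finset.mem_product.2 ⟨?_, ?_⟩⟩
    · exact hn₀ n hn (Finset.mem_union_left _ (Finset.mem_image_of_mem _ hp))
    · exact hn₀ n hn (Finset.mem_union_right _ (Finset.mem_image_of_mem _ hp))
  -- (3) uniform convergence of the third cumulants along the truncations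
  have hconv₂ : ∀ p : Finset (ZdEdge d) × Finset (ZdEdge d), TendstoUniformlyOn
      (fun n s => cov[fun U => F U * V' p.1 U, V p.2; νn n s] - (∫ U, F U ∂(νn n s)) * cov[V' p.1, V p.2; νn n s] -
        (∫ U, V' p.1 U ∂(νn n s)) * cov[F, V p.2; νn n s])
      (fun s => cov[fun U => F U * V' p.1 U, V p.2; ν s] - (∫ U, F U ∂(ν s)) * cov[V' p.1, V p.2; ν s] -
        (∫ U, V' p.1 U ∂(ν s)) * cov[F, V p.2; ν s]) atTop J := by
    intro p
    obtain ⟨CX, hCX⟩ := hVb' p.1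
    obtain ⟨CY, hCY⟩ := hVb p.2
    have hCX0 : 0 ≤ CX := (abs_nonneg _).trans (hCX fun _ => 1)
    have hCY0 : 0 ≤ CY := (abs_nonneg _).trans (hCY fun _ => 1)
    have h1 := hcovconv (show Measurable (fun U => F U * V' p.1 U) from hFm.mul (hV'm p.1)) (dependsOn_mul_union hFdep (hV'dep p.1))
      (fun σ => (abs_mul _ _).trans_le (mul_le_mul (hMF σ) (hCX σ) (abs_nonneg _) hMF0))
      (isLipBound_mul_of_abs_le (fun _ _ => suFrobDist_nonneg _ _) hMF0 hCX0 hMF hCX hδF (hlipV' p.1)) (hVm p.2) (hV.dependsOn p.2) hCY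
      (hlipV p.2)
    have h2 := hcovconv (hV'm p.1) (hV'dep p.1) hCX (hlipV' p.1) (hVm p.2) (hV.dependsOn p.2) hCY (hlipV p.2)
    have h3 := hcovconv hFm hFdep hMF hδF (hVm p.2) (hV.dependsOn p.2) hCY (hlipV p.2)
    have h24 := tendstoUniformlyOn_mul_of_abs_le (M₁ := MF) (M₂ := 2 * CX * CY) hMF0 (by positivity) (hunif hFm hFdep hMF hδF) h2
      (fun s hs => by haveI := hprob s hs; exact abs_integral_le_of_abs_le hMF)
      (fun s hs => by haveI := hprob s hs; exact abs_covariance_le_two_mul (hV'm p.1) hCX (hVm p.2) hCY)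
    have h35 := tendstoUniformlyOn_mul_of_abs_le (M₁ := CX) (M₂ := 2 * MF * CY) hCX0 (by positivity)
      (hunif (hV'm p.1) (hV'dep p.1) hCX (hlipV' p.1)) h3 (fun s hs => by haveI := hprob s hs; exact abs_integral_le_of_abs_le hCX)
      (fun s hs => by haveI := hprob s hs; exact abs_covariance_le_two_mul hFm hMF (hVm p.2) hCY)
    exact (h1.sub h24).sub h35
  have hU₂ := tendstoUniformlyOn_finsetSum_tsum hT₂ hΦ₂0 hΦ₂s hc₂ hcinf₂ hconv₂
  -- (3') each pair-truncated cumulant sum is continuous in `s` (tilt formula), hence so is the uniform limit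
  have hcont₂ : ∀ n, ContinuousOn (fun s => ∑ p ∈ T n ×ˢ T n, (cov[fun U => F U * V' p.1 U, V p.2; νn n s] -
      (∫ U, F U ∂(νn n s)) * cov[V' p.1, V p.2; νn n s] - (∫ U, V' p.1 U ∂(νn n s)) * cov[F, V p.2; νn n s])) J := by
    intro n
    choose CA hCA using fun A => exists_bound_of_continuous (hVnc n A)
    have hHm : Measurable fun U : LGConfig d (Matrix.specialUnitaryGroup (Fin N) ℂ) => ∑ A ∈ T n, Vn n A U :=
      Finset.measurable_sum _ fun A _ => (hVnc n A).measurable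
    have hHb : ∀ U : LGConfig d (Matrix.specialUnitaryGroup (Fin N) ℂ), |∑ A ∈ T n, Vn n A U| ≤ ∑ A ∈ T n, CA A := fun U =>
      (Finset.abs_sum_le_sum_abs _ _).trans (Finset.sum_le_sum fun A _ => hCA A U)
    haveI := (show IsGibbsMeasure _ μ from hμ).isProbabilityMeasure
    have hint : ∀ {g : LGConfig d (Matrix.specialUnitaryGroup (Fin N) ℂ) → ℝ} {M : ℝ}, Measurable g → (∀ σ, |g σ| ≤ M) →
        Continuous fun s => ∫ σ, g σ ∂(νn n s) := fun hgm hM =>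
      continuous_iff_continuousAt.2 fun s =>
        (hasDerivAt_integral_tilted_of_bounded (μ := μ) hHm hHb hgm.aestronglyMeasurable hM s).continuousAt
    have hcovc : ∀ {f g : LGConfig d (Matrix.specialUnitaryGroup (Fin N) ℂ) → ℝ} {Mf Mg : ℝ}, Measurable f → Measurable g →
        (∀ σ, |f σ| ≤ Mf) → (∀ σ, |g σ| ≤ Mg) → Continuous fun s => cov[f, g; νn n s] := by
      intro f g Mf Mg hfm hgm hMf hMg
      have hMf0 : 0 ≤ Mf := (abs_nonneg _).trans (hMf fun _ => 1)
      have heq : (fun s => cov[f, g; νn n s]) = fun s => (∫ σ, f σ * g σ ∂(νn n s)) - (∫ σ, f σ ∂(νn n s)) * ∫ σ, g σ ∂(νn n s) :=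
        funext fun s => by
          have hf2 : MemLp f 2 (νn n s) :=
            MemLp.of_bound hfm.aestronglyMeasurable Mf (Eventually.of_forall fun σ => by rw [Real.norm_eq_abs]; exact hMf σ)
          have hg2 : MemLp g 2 (νn n s) :=
            MemLp.of_bound hgm.aestronglyMeasurable Mg (Eventually.of_forall fun σ => by rw [Real.norm_eq_abs]; exact hMg σ)
          rw [covariance_eq_sub hf2 hg2]; rfl
      rw [heq]
      exact (hint (show Measurable (fun σ => f σ * g σ) from hfm.mul hgm) (M := Mf * Mg) fun σ =>
        (abs_mul _ _).trans_le (mul_le_mul (hMf σ) (hMg σ) (abs_nonneg _) hMf0)).sub ((hint hfm hMf).mul (hint hgm hMg))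
    refine continuousOn_finsetSum _ fun p _ => Continuous.continuousOn ?_
    obtain ⟨CX, hCX⟩ := hVb' p.1
    obtain ⟨CY, hCY⟩ := hVb p.2
    exact ((hcovc (show Measurable (fun U => F U * V' p.1 U) from hFm.mul (hV'm p.1)) (hVm p.2)
      (fun σ => (abs_mul _ _).trans_le (mul_le_mul (hMF σ) (hCX σ) (abs_nonneg _) hMF0)) hCY).sub
      ((hint hFm hMF).mul (hcovc (hV'm p.1) (hVm p.2) hCX hCY))).sub ((hint (hV'm p.1) hCX).mul (hcovc hFm (hVm p.2) hMF hCY))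
  -- (4) Feynman–Hellmann for the truncated susceptibility sums, on pairs
  have hderiv : ∀ n, ∀ s ∈ I, HasDerivAt (fun s => ∑ X ∈ T n, cov[F, V' X; νn n s])
      (-(∑ p ∈ T n ×ˢ T n, (cov[fun U => F U * V' p.1 U, V p.2; νn n s] - (∫ U, F U ∂(νn n s)) * cov[V' p.1, V p.2; νn n s] -
        (∫ U, V' p.1 U ∂(νn n s)) * cov[F, V p.2; νn n s]))) s := by
    intro n s _
    have hX : ∀ X ∈ T n, HasDerivAt (fun s => cov[F, V' X; νn n s])
        (-(∑ A ∈ T n, (cov[fun U => F U * V' X U, V A; νn n s] - (∫ U, F U ∂(νn n s)) * cov[V' X, V A; νn n s] -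
          (∫ U, V' X U ∂(νn n s)) * cov[F, V A; νn n s]))) s := by
      intro X _
      obtain ⟨CX, hCX⟩ := hVb' X
      have h := hasDerivAt_cov_of_mem_perturbedGibbsMeasuresS_add_smul (fundamentalRep (Fin N)) (continuous_fundamentalRep (Fin N)) (N * β) hBW
        hW'.continuous hW'.dependsOn (hVnc n) (hVndep n) (hVnsupp n) (fun _ => subset_rfl) huniq hμ (hνn n) hFm hMF (hV'm X) hCX s
      refine h.congr_deriv ?_
      congr 1
      refine sum_congr rfl fun A hA => ?_
      simp only [hVn, Set.indicator_of_mem (Finset.mem_coe.2 hA)]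
    have hs := HasDerivAt.fun_sum hX
    rw [Finset.sum_product, ← sum_neg_distrib]
    exact hs
  -- (5) assemble with the truncated-series derivative lemma on pairs
  exact ⟨fun s hs => hasDerivAt_of_truncations hT₂ hΦ₂0 hΦ₂s isOpen_Ioo (fun n s hs p => hc₂ n s (hII hs) p)
      (fun s hs p => hcinf₂ s (hII hs) p) (fun p => (hconv₂ p).mono hII) hderiv (fun s hs => hU₁.tendsto_at (hII hs)) hs,
    hU₂.continuousOn (Eventually.of_forall hcont₂).frequently⟩

/-- ★★★ **THE STATE IS `C²` ALONG EVERY DIRECTION OF FINITE SIZE-WEIGHTED LOAD.**  Under the hypotheses of `hasDerivAt_tsum_cov_direction_S`,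
`s ↦ ∫ F dν(s)` is `ContDiffOn ℝ 2` on `(−s₀, s₀)`: its derivative is `−Σ'_X cov_{ν(s)}(F, V_X)` (`hasDerivAt_and_continuousOn_direction_S`), whose
derivative is the continuous double cumulant series `Σ'_{(X,Y)} u₃^{ν(s)}(F; V_X; V_Y)` (`hasDerivAt_tsum_cov_direction_S`). -/
theorem contDiffOn_two_integral_direction_S (hd : 1 ≤ d) (hN : 1 ≤ N) {β b c v a' Λ' t : ℝ}
    (hc : 0 ≤ c) (hv : 0 ≤ v) (hb : |β| * (2 * ((d : ℝ) - 1)) ≤ b)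
    (hP : ∀ B : Matrix (Fin N) (Fin N) ℂ, matrixOpNorm B ≤ b →
      ∀ (ψ : Matrix.specialUnitaryGroup (Fin N) ℂ → ℝ) (M : ℝ), 0 ≤ M →
        (∀ x y, |ψ x - ψ y| ≤ M * suFrobDist x y) →
        Var[ψ; (haarProbability (Matrix.specialUnitaryGroup (Fin N) ℂ)).tilted
          fun g => (N : ℝ) * ((g : Matrix (Fin N) (Fin N) ℂ) * B).trace.re] ≤ c * M ^ 2)
    (hVB : ∀ B : Matrix (Fin N) (Fin N) ℂ, matrixOpNorm B ≤ b → ∀ Δ : Matrix (Fin N) (Fin N) ℂ,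
      Var[fun g : Matrix.specialUnitaryGroup (Fin N) ℂ =>
          (N : ℝ) * ((g : Matrix (Fin N) (Fin N) ℂ) * Δ).trace.re;
        (haarProbability (Matrix.specialUnitaryGroup (Fin N) ℂ)).tilted
          fun g => (N : ℝ) * ((g : Matrix (Fin N) (Fin N) ℂ) * B).trace.re] ≤ v * frobNorm Δ ^ 2)
    (ht : 0 < t) (hρ : 6 * ((d : ℝ) - 1) * |β| * (exp a' * exp t * Real.sqrt (c * v)) + exp (a' / 2) * Real.sqrt c * Λ' < 1)
    {a Λ aV ΛV s₀ : ℝ} (hW : MemBallZdS a Λ t W) (hV : MemBallZdS aV ΛV t V) (haV : 0 ≤ aV) (hΛV : 0 ≤ ΛV)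
    (hs₀ : 0 < s₀) (ha' : a + s₀ * aV ≤ a') (hΛ' : Λ + s₀ * ΛV ≤ Λ')
    {lipV : Finset (ZdEdge d) → ZdEdge d → ℝ} (hlipV : ∀ X, IsLipBound suFrobDist (V X) (lipV X)) {L L₂ : ℝ}
    (hLs : ∀ e, Summable fun X : Finset (ZdEdge d) => (if e ∈ X then ∑ y ∈ X, lipV X y else 0))
    (hL : ∀ e, ∑' X : Finset (ZdEdge d), (if e ∈ X then ∑ y ∈ X, lipV X y else 0) ≤ L)
    (hL2s : ∀ e, Summable fun X : Finset (ZdEdge d) => (if e ∈ X then X.card * ∑ y ∈ X, lipV X y else 0))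
    (hL2 : ∀ e, ∑' X : Finset (ZdEdge d), (if e ∈ X then X.card * ∑ y ∈ X, lipV X y else 0) ≤ L₂)
    {ν : ℝ → Measure (LGConfig d (Matrix.specialUnitaryGroup (Fin N) ℂ))}
    (hν : ∀ s ∈ Set.Icc (-s₀) s₀, ν s ∈ perturbedGibbsMeasuresS (d := d) (fundamentalRep (Fin N)) (N * β) (W + s • V))
    {F : LGConfig d (Matrix.specialUnitaryGroup (Fin N) ℂ) → ℝ} (hFm : Measurable F) {ΛF : Finset (ZdEdge d)}
    (hFdep : DependsOn F (↑ΛF : Set (ZdEdge d))) {MF : ℝ} (hMF : ∀ σ, |F σ| ≤ MF) {δF : ZdEdge d → ℝ}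
    (hδF : IsLipBound suFrobDist F δF) :
    ContDiffOn ℝ 2 (fun s => ∫ U, F U ∂(ν s)) (Set.Ioo (-s₀) s₀) := by
  obtain ⟨h1, -⟩ := hasDerivAt_and_continuousOn_direction_S hd hN hc hv hb hP hVB ht hρ hW hV haV hΛV hs₀ ha' hΛ' hlipV hLs hL hν
    hFm hFdep hMF hδF
  obtain ⟨h2, h3⟩ := hasDerivAt_tsum_cov_direction_S hd hN hc hv hb hP hVB ht hρ hW hV haV hΛV hs₀ ha' hΛ' hlipV hLs hL hL2s hL2 hV.continuous
    hV.dependsOn hlipV hLs hL hL2s hL2 hν hFm hFdep hMF hδF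
  rw [show (2 : WithTop ℕ∞) = 1 + 1 from one_add_one_eq_two.symm, contDiffOn_succ_iff_deriv_of_isOpen isOpen_Ioo]
  refine ⟨fun s hs => (h1 s hs).differentiableAt.differentiableWithinAt, fun h => absurd h (by simp), ?_⟩
  exact (Summit.Ventures.YMGap.CouplingResponse.contDiffOn_one_of_hasDerivAt (fun s hs => (h2 s hs).neg) h3.neg.neg).congr
    fun s hs => (h1 s hs).deriv

end SUN

end Summit.Ventures.YMGap.RobustBall

end
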